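import Summits.FinalStateConjecture.FinalStateConjecture.Theorems.PhotonSphereChannelsExteriorEnergyRW

/-!
# `WindowedShellChannels` (crux stmt-FinalStateConjecture-14085, route `PhotonSphereChannels`) —
# the `ℝ≥0∞` corner is harmless: infinite-energy solutions make BOTH lagged channel energies `⊤`

The crux quantifies over ALL global `C²` Regge–Wheeler solutions, with energies valued in `ℝ≥0∞`
and no finiteness hypothesis, and its left-hand side `ENNReal.ofReal c * totalEnergy … ψ 0` is `⊤`
as soon as the data have infinite energy.  This file (refuter cdisprove seat; everything proved,
no definitions) records why that is not a loophole and hands the provers the reduction to finite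
energy:

* `exteriorEnergy_eq_top_of_far_tail` / `exteriorEnergy_eq_top_of_near_tail` — if the energy of
  the data on every far half-line `(N, ∞)` (resp. near half-line `(−∞, N)`) is infinite, then the
  exterior energy of ANY aperture `a` (lagged apertures `ρ − h < 0` included) is `⊤` at every time
  with `a + |t| ≥ 0`: by the expanding-region energy inequality (past domain of dependence,
  `WaveEnergy.lintegral_Ioi_le_expanding` / `…_shrinking_le` of the tree) the energy on
  `{x > xc + a + |t|}` at time `t` dominates the energy of the data on `{x > xc + a + 2|t|}`;
* `far_tail_or_near_tail_of_totalEnergy_eq_top` — an infinite total energy of `C²` data sits in a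
  far or a near tail (the density is continuous, hence finite on compact intervals);
* `channelEnergy_eq_top_of_totalEnergy_eq_top` — hence both `channelEnergy V xc a ψ atTop` and
  `… atBot` are `⊤`, and (`windowedShell_inner_of_totalEnergy_eq_top`, Regge–Wheeler instance) the
  inner inequality of the crux holds trivially for infinite-energy solutions: provers may assume
  `totalEnergy … ψ 0 < ⊤`.
-/

noncomputable section

set_option linter.dupNamespace false

namespace Summit.FinalStateConjecture.FinalStateConjecture.Theorems.WindowedShellChannels.Negative

open Literature.Geometry.Lorentzian Literature.Geometry.Lorentzian.ReggeWheeler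
open MeasureTheory Filter Set Function
open scoped ENNReal Topology

section General

variable {V : ℝ → ℝ} {ψ : ℝ → ℝ → ℝ}

/-- Dictionary: a global `C²` solution in the route's `iteratedDeriv` form solves the equation in
Fréchet form, and its energy density is the Fréchet-form density. -/
theorem frechet_of_isSolution (hψ : IsSolution V ψ) :
    (∀ z : ℝ × ℝ, fderiv ℝ (fderiv ℝ (Function.uncurry ψ)) z (1, 0) (1, 0)
      - fderiv ℝ (fderiv ℝ (Function.uncurry ψ)) z (0, 1) (0, 1)
      + V z.2 * Function.uncurry ψ z = 0) ∧
    (∀ z : ℝ × ℝ, (fun z : ℝ × ℝ => energyDensity V ψ z.1 z.2) z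
      = (fderiv ℝ (Function.uncurry ψ) z (1, 0)) ^ 2 + (fderiv ℝ (Function.uncurry ψ) z (0, 1)) ^ 2
        + V z.2 * Function.uncurry ψ z ^ 2) := by
  have hψ2 := hψ.1
  refine ⟨?_, ?_⟩
  · rintro ⟨t, x⟩
    rw [← WaveEnergy.iteratedDeriv_two_slice_fst_eq hψ2, ← WaveEnergy.iteratedDeriv_two_slice_snd_eq hψ2]
    exact hψ.2 (t, x)
  · rintro ⟨t, x⟩
    simp only [Function.uncurry_apply_pair, energyDensity]
    rw [WaveEnergy.deriv_slice_fst_eq hψ2, WaveEnergy.deriv_slice_snd_eq hψ2]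

/-- **Far tail.** If the data have infinite energy on every far half-line, every exterior energy
(any aperture `a`, any time with `0 ≤ a + |t|`) is `⊤`. [folklore] -/
theorem exteriorEnergy_eq_top_of_far_tail (hV : Differentiable ℝ V) (hV0 : ∀ x, 0 ≤ V x)
    (hψ : IsSolution V ψ) (xc a : ℝ)
    (htail : ∀ N : ℝ, ∫⁻ x in Ioi N, ENNReal.ofReal (energyDensity V ψ 0 x) = ⊤)
    {t : ℝ} (hat : 0 ≤ a + |t|) : exteriorEnergy V xc a ψ t = ⊤ := by
  obtain ⟨hsol', he⟩ := frechet_of_isSolution hψ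
  have hψ2 := hψ.1
  have hsub : Ioi (xc + (a + |t|)) ⊆ {x : ℝ | a + |t| < |x - xc|} := fun x hx => by
    simp only [mem_Ioi] at hx
    simp only [mem_setOf_eq]
    rw [abs_of_pos (show 0 < x - xc by linarith [abs_nonneg t])]
    linarith
  refine eq_top_iff.2 ?_
  unfold exteriorEnergy
  refine le_trans ?_ (lintegral_mono_set hsub)
  rw [← htail (xc + (a + |t|) + |t|)]
  rcases le_or_gt 0 t with ht | ht
  · -- forward in time: expanding region read from time `0` to time `t`
    have key := WaveEnergy.lintegral_Ioi_le_expanding hψ2 hV hV0 hsol' he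
      (xc + (a + |t|) + |t|) ht
    have e1 : xc + (a + |t|) + |t| - (t - 0) = xc + (a + |t|) := by rw [abs_of_nonneg ht]; ring
    rw [e1] at key
    exact key
  · -- backward in time: shrinking region read from time `t < 0` to time `0`
    have key := WaveEnergy.lintegral_Ioi_shrinking_le hψ2 hV hV0 hsol' he (xc + (a + |t|)) ht.le
    have e1 : xc + (a + |t|) + (0 - t) = xc + (a + |t|) + |t| := by rw [abs_of_neg ht]; ring
    rw [e1] at key
    exact key

/-- **Near tail.** If the data have infinite energy on every near half-line, every exterior energy
(any aperture `a`, any time with `0 ≤ a + |t|`) is `⊤`. [folklore] -/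
theorem exteriorEnergy_eq_top_of_near_tail (hV : Differentiable ℝ V) (hV0 : ∀ x, 0 ≤ V x)
    (hψ : IsSolution V ψ) (xc a : ℝ)
    (htail : ∀ N : ℝ, ∫⁻ x in Iio N, ENNReal.ofReal (energyDensity V ψ 0 x) = ⊤)
    {t : ℝ} (hat : 0 ≤ a + |t|) : exteriorEnergy V xc a ψ t = ⊤ := by
  obtain ⟨hsol', he⟩ := frechet_of_isSolution hψ
  have hψ2 := hψ.1
  have hsub : Iio (xc - (a + |t|)) ⊆ {x : ℝ | a + |t| < |x - xc|} := fun x hx => by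
    simp only [mem_Iio] at hx
    simp only [mem_setOf_eq]
    rw [abs_of_neg (show x - xc < 0 by linarith [abs_nonneg t])]
    linarith
  refine eq_top_iff.2 ?_
  unfold exteriorEnergy
  refine le_trans ?_ (lintegral_mono_set hsub)
  rw [← htail (xc - (a + |t|) - |t|)]
  rcases le_or_gt 0 t with ht | ht
  · have key := WaveEnergy.lintegral_Iio_le_expanding hψ2 hV hV0 hsol' he
      (xc - (a + |t|) - |t|) ht
    have e1 : xc - (a + |t|) - |t| + (t - 0) = xc - (a + |t|) := by rw [abs_of_nonneg ht]; ring
    rw [e1] at key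
    exact key
  · have key := WaveEnergy.lintegral_Iio_shrinking_le hψ2 hV hV0 hsol' he (xc - (a + |t|)) ht.le
    have e1 : xc - (a + |t|) - (0 - t) = xc - (a + |t|) - |t| := by rw [abs_of_neg ht]; ring
    rw [e1] at key
    exact key

/-- **Where infinite energy sits.** For a global `C²` solution (`V` differentiable) with
`totalEnergy V ψ 0 = ⊤`, either every far half-line or every near half-line of the data carries
infinite energy (the density is continuous, so compact intervals carry finite energy). [folklore] -/
theorem far_tail_or_near_tail_of_totalEnergy_eq_top (hV : Differentiable ℝ V)
    (hψ : IsSolution V ψ) (hE : totalEnergy V ψ 0 = ⊤) :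
    (∀ N : ℝ, ∫⁻ x in Ioi N, ENNReal.ofReal (energyDensity V ψ 0 x) = ⊤) ∨
      (∀ N : ℝ, ∫⁻ x in Iio N, ENNReal.ofReal (energyDensity V ψ 0 x) = ⊤) := by
  obtain ⟨-, he⟩ := frechet_of_isSolution hψ
  have hψ2 := hψ.1
  -- the density at time `0` is continuous
  have hcont : Continuous fun x => energyDensity V ψ 0 x := by
    have h := WaveEnergy.continuous_energyDensity hψ2 hV he
    exact h.comp (Continuous.prodMk_right (0 : ℝ))
  by_contra hcon
  rw [not_or, not_forall, not_forall] at hcon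
  obtain ⟨⟨N₁, hN₁⟩, ⟨N₂, hN₂⟩⟩ := hcon
  -- finite energy on a compact middle piece
  set f : ℝ → ℝ≥0∞ := fun x => ENNReal.ofReal (energyDensity V ψ 0 x) with hf
  obtain ⟨K, hK⟩ := (isCompact_Icc (a := N₂) (b := N₁)).exists_bound_of_continuousOn hcont.continuousOn
  have hmid : ∫⁻ x in Icc N₂ N₁, f x < ⊤ := by
    have hb : ∀ x ∈ Icc N₂ N₁, f x ≤ ENNReal.ofReal K := fun x hx =>
      ENNReal.ofReal_le_ofReal ((le_abs_self _).trans ((Real.norm_eq_abs _).symm.le.trans (hK x hx)))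
    calc ∫⁻ x in Icc N₂ N₁, f x ≤ ∫⁻ _ in Icc N₂ N₁, ENNReal.ofReal K :=
          setLIntegral_mono measurable_const hb
      _ = ENNReal.ofReal K * volume (Icc N₂ N₁) := setLIntegral_const _ _
      _ < ⊤ := ENNReal.mul_lt_top ENNReal.ofReal_lt_top (by rw [Real.volume_Icc]; exact ENNReal.ofReal_lt_top)
  -- the whole line is covered by the three pieces
  have hcover : (univ : Set ℝ) ⊆ (Iio N₂ ∪ Icc N₂ N₁) ∪ Ioi N₁ := by
    intro x _
    rcases lt_or_ge x N₂ with h | h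
    · exact Or.inl (Or.inl h)
    · rcases le_or_gt x N₁ with h' | h'
      · exact Or.inl (Or.inr ⟨h, h'⟩)
      · exact Or.inr h'
  have htot : ∫⁻ x, f x < ⊤ := by
    calc ∫⁻ x, f x = ∫⁻ x in univ, f x := (setLIntegral_univ f).symm
      _ ≤ ∫⁻ x in (Iio N₂ ∪ Icc N₂ N₁) ∪ Ioi N₁, f x := lintegral_mono_set hcover
      _ ≤ (∫⁻ x in Iio N₂ ∪ Icc N₂ N₁, f x) + ∫⁻ x in Ioi N₁, f x := lintegral_union_le _ _ _
      _ ≤ ((∫⁻ x in Iio N₂, f x) + ∫⁻ x in Icc N₂ N₁, f x) + ∫⁻ x in Ioi N₁, f x := by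
          gcongr
          exact lintegral_union_le _ _ _
      _ < ⊤ := by
          refine ENNReal.add_lt_top.2 ⟨ENNReal.add_lt_top.2 ⟨lt_top_iff_ne_top.2 hN₂, hmid⟩,
            lt_top_iff_ne_top.2 hN₁⟩
  unfold totalEnergy at hE
  exact (lt_top_iff_ne_top.1 htot) hE

/-- **Both lagged channel energies of an infinite-energy solution are `⊤`** (`V ≥ 0`
differentiable; any centre, any aperture, any of the two time filters). [folklore] -/
theorem channelEnergy_eq_top_of_totalEnergy_eq_top (hV : Differentiable ℝ V) (hV0 : ∀ x, 0 ≤ V x)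
    (hψ : IsSolution V ψ) (xc a : ℝ) (hE : totalEnergy V ψ 0 = ⊤) :
    channelEnergy V xc a ψ atTop = ⊤ ∧ channelEnergy V xc a ψ atBot = ⊤ := by
  have hext : ∀ t, 0 ≤ a + |t| → exteriorEnergy V xc a ψ t = ⊤ := by
    intro t hat
    rcases far_tail_or_near_tail_of_totalEnergy_eq_top hV hψ hE with h | h
    · exact exteriorEnergy_eq_top_of_far_tail hV hV0 hψ xc a h hat
    · exact exteriorEnergy_eq_top_of_near_tail hV hV0 hψ xc a h hat
  unfold channelEnergy
  constructor
  · have hev : ∀ᶠ t in atTop, exteriorEnergy V xc a ψ t = (fun _ => (⊤ : ℝ≥0∞)) t := by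
      filter_upwards [eventually_ge_atTop |a|] with t ht
      exact hext t (by linarith [neg_abs_le a, le_abs_self t])
    rw [liminf_congr hev, liminf_const]
  · have hev : ∀ᶠ t in atBot, exteriorEnergy V xc a ψ t = (fun _ => (⊤ : ℝ≥0∞)) t := by
      filter_upwards [eventually_le_atBot (-|a|)] with t ht
      exact hext t (by linarith [neg_abs_le a, neg_le_abs t])
    rw [liminf_congr hev, liminf_const]

end General

/-- **Regge–Wheeler instance, in the shape of the crux**: for a tortoise radius function, `s ≤ ℓ`,
and a global `C²` Regge–Wheeler solution of infinite total energy, the inner inequality of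
`WindowedShellChannels` holds for every constant `c` and every (lagged) aperture `a` — so the
crux is a statement about finite-energy solutions only. [folklore] -/
theorem windowedShell_inner_of_totalEnergy_eq_top {M : ℝ} {r : ℝ → ℝ} {xc : ℝ} {s ℓ : ℕ}
    {ψ : ℝ → ℝ → ℝ} (hr : IsTortoiseRadius M r xc) (hsℓ : s ≤ ℓ) (hψ : IsRWSolution M s ℓ r ψ)
    (c a : ℝ) (hE : totalEnergy (linePotential M s ℓ r) ψ 0 = ⊤) :
    ENNReal.ofReal c * totalEnergy (linePotential M s ℓ r) ψ 0 ≤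
      channelEnergy (linePotential M s ℓ r) xc a ψ atTop +
        channelEnergy (linePotential M s ℓ r) xc a ψ atBot := by
  obtain ⟨h1, -⟩ := channelEnergy_eq_top_of_totalEnergy_eq_top (RW.differentiable_linePotential hr s ℓ)
    (fun x => (RW.linePotential_pos hr hsℓ x).le) hψ xc a hE
  rw [h1, top_add]
  exact le_top

end Summit.FinalStateConjecture.FinalStateConjecture.Theorems.WindowedShellChannels.Negative

end
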